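import Summits.Ventures.WeilGRH.TwistedSechTable
import HarnessLib

/-!
# GRH arm (rh-explicit, venture WeilGRH): the `sech` block VALUES as interval boxes — part II, the DIAGONAL entry

Cell `rh-explicit`, WEIL TRACK — GRH ARM (engine seat weil-grh-2 gen8).  Sequel of `TwistedSechTable.lean` (sine values
`I_n` and the off-diagonal entries of `sechIncrCoeff a`): the diagonal entry
`sechIncrCoeff a n n = 2π − 4 arctan(e^{a}) + ∫_{(0,2a]} σ(t)(2 − 2(1 − t/2a) cos ω_n t) dt`.  Closed forms of the
elementary integrals `∫ e^{−lt}cos`, `∫ t e^{−lt} cos`, `∫ e^{−lt}` at `ω_n·2a = 2πn` (weil-2's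
`WeilFormatCEntryArchIntegrals.lean`), weil-grh-1's remainder `abs_sechIncrCoeff_diag_sub_sum_le`, and the interval layer:

* `SechEncl.diagClosed_eq`, `abs_sechDiag_sub_sum_le` — the diagonal elementary integral in closed form and the per-mode
  remainder `(2aω_n² + 1/a)/(K+½)²`;
* `SechEncl.diagTerm` / `diagSum` / `tailBox` (`2π − 4 arctan e^{a}` by weil-2's `MI.arctan`) / `diagRemBox` / `diagBox` with
  ★ `mem_diagBox` — `sechIncrCoeff a n n ∈ diagBox` for `Ω ∋ πn/a`.

Needed only for the block modes (`n < B ≤ 8` in the complete-rung cells `(−3/·) @ 2/5`, `(−3/·), (−4/·) @ (log 3)/2`).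
Everything is PROVED; computable `def`s with docstrings; no named facts; RH/GRH-free; standard axioms.
References: H. Yoshida (1992) §5 [Yoshida1992HermitianForms]; R. E. Moore (1966) Ch. 3 [Moore1966].
-/

set_option autoImplicit false

open Real MeasureTheory Set Finset
open scoped BigOperators

namespace Summit.Ventures.WeilGRH

open Literature.Analysis.ValidatedNumerics.NumericsMP
open Summit.RiemannHypothesis.RiemannHypothesis.Theorems.WeilFormatC

namespace SechEncl

variable {a : ℝ}

/-! ## The diagonal elementary integral in closed form -/


/-- `∫_{(0,2a]} e^{−lt} cos(πn t/a) dt = l(1 − e^{−2al})/(l² + ω²)`. -/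
theorem cosClosed_eq (ha : 0 < a) (n : ℤ) {l : ℝ} (hl : 0 < l) :
    ∫ t in Ioc 0 (2 * a), Real.exp (-(l * t)) * Real.cos (π * n / a * t)
      = l * (1 - Real.exp (-(l * (2 * a)))) / (l ^ 2 + (π * n / a) ^ 2) := by
  rw [← intervalIntegral.integral_of_le (by positivity : (0 : ℝ) ≤ 2 * a)]
  have hωT : π * n / a * (2 * a) = 2 * π * n := by field_simp
  exact integral_exp_neg_mul_cos hωT (by positivity)

/-- `∫_{(0,2a]} t e^{−lt} cos(πn t/a) dt` in closed form. -/
theorem mulCosClosed_eq (ha : 0 < a) (n : ℤ) {l : ℝ} (hl : 0 < l) :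
    ∫ t in Ioc 0 (2 * a), t * Real.exp (-(l * t)) * Real.cos (π * n / a * t)
      = (l ^ 2 - (π * n / a) ^ 2) * (1 - Real.exp (-(l * (2 * a)))) / (l ^ 2 + (π * n / a) ^ 2) ^ 2
          - (2 * a) * Real.exp (-(l * (2 * a))) * l / (l ^ 2 + (π * n / a) ^ 2) := by
  rw [← intervalIntegral.integral_of_le (by positivity : (0 : ℝ) ≤ 2 * a)]
  have hωT : π * n / a * (2 * a) = 2 * π * n := by field_simp
  exact integral_mul_exp_neg_mul_cos hωT (by positivity)

/-- `∫_{(0,2a]} e^{−lt} dt = (1 − e^{−2al})/l`. -/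
theorem expClosed_eq (ha : 0 < a) {l : ℝ} (hl : 0 < l) :
    ∫ t in Ioc 0 (2 * a), Real.exp (-(l * t)) = (1 - Real.exp (-(l * (2 * a)))) / l := by
  rw [← intervalIntegral.integral_of_le (by positivity : (0 : ℝ) ≤ 2 * a)]
  exact integral_exp_neg_mul hl.ne' (2 * a)

/-- The DIAGONAL elementary integral `∫_{(0,2a]} e^{−lt}(2 − 2(1 − t/2a)cos(πn t/a)) dt` in closed form. -/
theorem diagClosed_eq (ha : 0 < a) (n : ℤ) {l : ℝ} (hl : 0 < l) :
    ∫ t in Ioc 0 (2 * a), Real.exp (-(l * t)) * (2 - 2 * (1 - t / (2 * a)) * Real.cos (π * n / a * t))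
      = 2 * ((1 - Real.exp (-(l * (2 * a)))) / l)
        - 2 * (l * (1 - Real.exp (-(l * (2 * a)))) / (l ^ 2 + (π * n / a) ^ 2))
        + (1 / a) * ((l ^ 2 - (π * n / a) ^ 2) * (1 - Real.exp (-(l * (2 * a)))) / (l ^ 2 + (π * n / a) ^ 2) ^ 2
            - (2 * a) * Real.exp (-(l * (2 * a))) * l / (l ^ 2 + (π * n / a) ^ 2)) := by
  have h2a : (0 : ℝ) < 2 * a := by positivity
  -- integrability on `Ioc 0 (2a)` of the three pieces (continuous on a bounded interval)
  have hint : ∀ {g : ℝ → ℝ}, Continuous g → IntegrableOn g (Ioc 0 (2 * a)) := fun hg ↦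
    (hg.continuousOn.integrableOn_Icc).mono_set Ioc_subset_Icc_self
  have e : ∀ t : ℝ, Real.exp (-(l * t)) * (2 - 2 * (1 - t / (2 * a)) * Real.cos (π * n / a * t))
      = 2 * Real.exp (-(l * t)) - 2 * (Real.exp (-(l * t)) * Real.cos (π * n / a * t))
        + (1 / a) * (t * Real.exp (-(l * t)) * Real.cos (π * n / a * t)) := by
    intro t; field_simp; ring
  simp_rw [e]
  have hA : IntegrableOn (fun t : ℝ ↦ 2 * Real.exp (-(l * t))) (Ioc 0 (2 * a)) := hint (by fun_prop)
  have hB : IntegrableOn (fun t : ℝ ↦ 2 * (Real.exp (-(l * t)) * Real.cos (π * n / a * t))) (Ioc 0 (2 * a)) :=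
    hint (by fun_prop)
  have hAB : IntegrableOn (fun t : ℝ ↦ 2 * Real.exp (-(l * t)) - 2 * (Real.exp (-(l * t)) * Real.cos (π * n / a * t)))
      (Ioc 0 (2 * a)) := hint (by fun_prop)
  have hC : IntegrableOn (fun t : ℝ ↦ 1 / a * (t * Real.exp (-(l * t)) * Real.cos (π * n / a * t))) (Ioc 0 (2 * a)) :=
    hint (by fun_prop)
  rw [integral_add hAB hC, integral_sub hA hB, integral_const_mul, integral_const_mul, integral_const_mul,
    expClosed_eq ha hl, cosClosed_eq ha n hl, mulCosClosed_eq ha n hl]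

/-! ## The diagonal entry with explicit remainder -/

/-- **The diagonal entry of mode `n` with remainder** (closed forms inserted into weil-grh-1's
`abs_sechIncrCoeff_diag_sub_sum_le`). -/
theorem abs_sechDiag_sub_sum_le (ha : 0 < a) (n : ℕ) (K : ℕ) :
    |sechIncrCoeff a n n - (2 * π - 4 * Real.arctan (Real.exp a)) -
        ∑ k ∈ Finset.range K, (-1 : ℝ) ^ k *
          (2 * ((1 - Real.exp (-((k + 1 / 2) * (2 * a)))) / (k + 1 / 2))
            - 2 * ((k + 1 / 2) * (1 - Real.exp (-((k + 1 / 2) * (2 * a)))) / ((k + 1 / 2) ^ 2 + (π * n / a) ^ 2))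
            + (1 / a) * (((k + 1 / 2) ^ 2 - (π * n / a) ^ 2) * (1 - Real.exp (-((k + 1 / 2) * (2 * a))))
                  / ((k + 1 / 2) ^ 2 + (π * n / a) ^ 2) ^ 2
                - (2 * a) * Real.exp (-((k + 1 / 2) * (2 * a))) * (k + 1 / 2) / ((k + 1 / 2) ^ 2 + (π * n / a) ^ 2)))|
      ≤ (2 * a * (π * n / a) ^ 2 + 1 / a) / (K + 1 / 2) ^ 2 := by
  have hsum : ∑ k ∈ Finset.range K, (-1 : ℝ) ^ k *
      (2 * ((1 - Real.exp (-((k + 1 / 2) * (2 * a)))) / (k + 1 / 2))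
        - 2 * ((k + 1 / 2) * (1 - Real.exp (-((k + 1 / 2) * (2 * a)))) / ((k + 1 / 2) ^ 2 + (π * n / a) ^ 2))
        + (1 / a) * (((k + 1 / 2) ^ 2 - (π * n / a) ^ 2) * (1 - Real.exp (-((k + 1 / 2) * (2 * a))))
              / ((k + 1 / 2) ^ 2 + (π * n / a) ^ 2) ^ 2
            - (2 * a) * Real.exp (-((k + 1 / 2) * (2 * a))) * (k + 1 / 2) / ((k + 1 / 2) ^ 2 + (π * n / a) ^ 2)))
      = ∑ k ∈ Finset.range K, (-1 : ℝ) ^ k *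
          ∫ t in Ioc 0 (2 * a), Real.exp (-((k + 1 / 2) * t)) * (2 - 2 * (1 - t / (2 * a)) * Real.cos (π * n / a * t)) := by
    refine Finset.sum_congr rfl fun k _ ↦ ?_
    have hl : (0 : ℝ) < k + 1 / 2 := by positivity
    have h := diagClosed_eq ha (n : ℤ) hl
    push_cast at h ⊢
    rw [h]
  rw [hsum]
  have h := abs_sechIncrCoeff_diag_sub_sum_le ha (n : ℤ) K
  push_cast at h ⊢
  exact h

/-! ## Interval boxes -/

section Boxes

variable {S : ℕ}


/-- One diagonal term `2(1−E)/l − 2l(1−E)/(l²+ω²) + (1/a)((l²−ω²)(1−E)/(l²+ω²)² − 2aEl/(l²+ω²))`, `l = l_k`.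
[cite: Moore1966, Ch. 3 (interval arithmetic: inclusion property)] -/
def diagTerm (S : ℕ) (A Ω Ek : MI) (k : ℕ) : Option MI :=
  let l := lBox S k
  let oneE := (MI.ofInt S 1).sub Ek
  let den := (l.sqr S).add (Ω.sqr S)
  match MI.divPos S (oneE.mulInt 2) l, MI.divPos S ((l.mul S oneE).mulInt 2) den,
    MI.divPos S (((l.sqr S).sub (Ω.sqr S)).mul S oneE) (den.sqr S),
    MI.divPos S ((((A.mulInt 2).mul S Ek).mul S l)) den with
  | some t1, some t2, some t3, some t4 =>
    match MI.divPos S (t3.sub t4) A with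
    | some t5 => some ((t1.sub t2).add t5)
    | none => none
  | _, _, _, _ => none

/-- `diagTerm` encloses the diagonal elementary integral's closed form. [cite: Moore1966, Ch. 3 (interval arithmetic: inclusion property)] -/
theorem mem_diagTerm (hS : 0 < S) (ha : 0 < a) {A Ω Ek T : MI} {ω E : ℝ} (hA : MI.mem S a A) (hΩ : MI.mem S ω Ω)
    (hE : MI.mem S E Ek) {k : ℕ} (h : diagTerm S A Ω Ek k = some T) :
    MI.mem S (2 * ((1 - E) / ((k : ℝ) + 1 / 2))
        - 2 * ((((k : ℝ) + 1 / 2)) * (1 - E) / ((((k : ℝ) + 1 / 2)) ^ 2 + ω ^ 2))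
        + (1 / a) * (((((k : ℝ) + 1 / 2)) ^ 2 - ω ^ 2) * (1 - E) / ((((k : ℝ) + 1 / 2)) ^ 2 + ω ^ 2) ^ 2
            - (2 * a) * E * (((k : ℝ) + 1 / 2)) / ((((k : ℝ) + 1 / 2)) ^ 2 + ω ^ 2))) T := by
  unfold diagTerm at h
  simp only at h
  have hl := mem_lBox S k
  have h1E : MI.mem S (1 - E) ((MI.ofInt S 1).sub Ek) := MI.mem_sub (mem_one S) hE
  have hden : MI.mem S ((((k : ℝ) + 1 / 2)) ^ 2 + ω ^ 2) (((lBox S k).sqr S).add (Ω.sqr S)) :=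
    MI.mem_add (MI.mem_sqr hS hl) (MI.mem_sqr hS hΩ)
  split at h
  · rename_i t1 t2 t3 t4 ht1 ht2 ht3 ht4
    split at h
    · rename_i t5 ht5
      simp only [Option.some.injEq] at h
      subst h
      have m1 : MI.mem S ((1 - E) * (2 : ℤ) / ((k : ℝ) + 1 / 2)) t1 := MI.mem_divPos hS ht1 (MI.mem_mulInt h1E 2) hl
      have m2 : MI.mem S ((((k : ℝ) + 1 / 2) * (1 - E)) * (2 : ℤ) / ((((k : ℝ) + 1 / 2)) ^ 2 + ω ^ 2)) t2 :=
        MI.mem_divPos hS ht2 (MI.mem_mulInt (MI.mem_mul hS hl h1E) 2) hden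
      have m3 : MI.mem S (((((k : ℝ) + 1 / 2)) ^ 2 - ω ^ 2) * (1 - E) / ((((k : ℝ) + 1 / 2)) ^ 2 + ω ^ 2) ^ 2) t3 :=
        MI.mem_divPos hS ht3 (MI.mem_mul hS (MI.mem_sub (MI.mem_sqr hS hl) (MI.mem_sqr hS hΩ)) h1E) (MI.mem_sqr hS hden)
      have m4 : MI.mem S (a * (2 : ℤ) * E * ((k : ℝ) + 1 / 2) / ((((k : ℝ) + 1 / 2)) ^ 2 + ω ^ 2)) t4 :=
        MI.mem_divPos hS ht4 (MI.mem_mul hS (MI.mem_mul hS (MI.mem_mulInt hA 2) hE) hl) hden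
      have m5 := MI.mem_divPos hS ht5 (MI.mem_sub m3 m4) hA
      have m := MI.mem_add (MI.mem_sub m1 m2) m5
      refine Literature.NumberTheory.LFunctions.Yoshida1992.Encl.mem_of_eq m ?_
      have hk : (0 : ℝ) < (k : ℝ) + 1 / 2 := by positivity
      have ha0 : a ≠ 0 := ha.ne'
      push_cast
      field_simp
    · simp at h
  · simp at h

/-- Alternating partial sum of the diagonal terms. [cite: Moore1966, Ch. 3 (interval arithmetic: inclusion property)] -/
def diagSum (S : ℕ) (A Ω E0 R : MI) : ℕ → Option MI
  | 0 => some (MI.ofInt S 0)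
  | K + 1 =>
    match diagSum S A Ω E0 R K, diagTerm S A Ω (expSeq S E0 R K) K with
    | some acc, some t => some (if K % 2 = 0 then acc.add t else acc.sub t)
    | _, _ => none

/-- `diagSum K` encloses the alternating partial sum of the diagonal closed forms.
[cite: Moore1966, Ch. 3 (interval arithmetic: inclusion property)] -/
theorem mem_diagSum (hS : 0 < S) (ha : 0 < a) {A Ω E0 R : MI} {ω : ℝ} (hA : MI.mem S a A) (hΩ : MI.mem S ω Ω)
    (hE0 : MI.mem S (Real.exp (-a)) E0) (hR : MI.mem S (Real.exp (-(2 * a))) R) :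
    ∀ (K : ℕ) {Y : MI}, diagSum S A Ω E0 R K = some Y →
      MI.mem S (∑ k ∈ Finset.range K, (-1 : ℝ) ^ k *
        (2 * ((1 - Real.exp (-((k + 1 / 2) * (2 * a)))) / (k + 1 / 2))
          - 2 * ((k + 1 / 2) * (1 - Real.exp (-((k + 1 / 2) * (2 * a)))) / ((k + 1 / 2) ^ 2 + ω ^ 2))
          + (1 / a) * (((k + 1 / 2) ^ 2 - ω ^ 2) * (1 - Real.exp (-((k + 1 / 2) * (2 * a))))
                / ((k + 1 / 2) ^ 2 + ω ^ 2) ^ 2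
              - (2 * a) * Real.exp (-((k + 1 / 2) * (2 * a))) * (k + 1 / 2) / ((k + 1 / 2) ^ 2 + ω ^ 2)))) Y
  | 0, Y, h => by
      simp only [diagSum, Option.some.injEq] at h
      subst h
      simpa using MI.mem_ofInt S 0
  | K + 1, Y, h => by
      simp only [diagSum] at h
      split at h
      · rename_i acc t hacc ht
        simp only [Option.some.injEq] at h
        subst h
        have ih := mem_diagSum hS ha hA hΩ hE0 hR K hacc
        have hterm := mem_diagTerm hS ha hA hΩ (mem_expSeq hS hE0 hR K) ht
        rw [Finset.sum_range_succ]
        by_cases hK : K % 2 = 0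
        · rw [if_pos hK]
          have hs : (-1 : ℝ) ^ K = 1 := by
            obtain ⟨j, hj⟩ := Nat.even_iff.mpr hK; rw [hj, ← two_mul, pow_mul]; norm_num
          rw [hs, one_mul]
          exact MI.mem_add ih hterm
        · rw [if_neg hK]
          have hs : (-1 : ℝ) ^ K = -1 := by
            have hK' : K % 2 = 1 := Nat.mod_two_ne_zero.mp hK
            obtain ⟨j, hj⟩ := Nat.odd_iff.mpr hK'; rw [hj, pow_succ, pow_mul]; norm_num
          rw [hs, neg_one_mul, ← sub_eq_add_neg]
          exact MI.mem_sub ih hterm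
      · simp at h

/-- The diagonal tail `2π − 4 arctan(e^{a})` from boxes `P ∋ π`, `EA ∋ e^{a}` (weil-2's `MI.arctan`).
[cite: Moore1966, Ch. 3 (interval arithmetic: inclusion property)] -/
def tailBox (S Karc : ℕ) (P EA : MI) : Option MI :=
  (MI.arctan S Karc P EA).map fun T ↦ (P.mulInt 2).sub (T.mulInt 4)

/-- `tailBox` encloses `2π − 4 arctan(e^{a})`. [cite: Moore1966, Ch. 3 (interval arithmetic: inclusion property)] -/
theorem mem_tailBox (hS : 0 < S) {Karc : ℕ} {P EA T : MI} (hP : MI.mem S Real.pi P) (hEA : MI.mem S (Real.exp a) EA)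
    (h : tailBox S Karc P EA = some T) : MI.mem S (2 * π - 4 * Real.arctan (Real.exp a)) T := by
  unfold tailBox at h
  cases harc : MI.arctan S Karc P EA with
  | none => simp [harc] at h
  | some Z =>
    simp only [harc, Option.map_some, Option.some.injEq] at h
    subst h
    have hZ := MI.mem_arctan hS hP harc hEA
    have h1 : MI.mem S (π * (2 : ℤ)) (P.mulInt 2) := MI.mem_mulInt hP 2
    have h2 : MI.mem S (Real.arctan (Real.exp a) * (4 : ℤ)) (Z.mulInt 4) := MI.mem_mulInt hZ 4
    refine Literature.NumberTheory.LFunctions.Yoshida1992.Encl.mem_of_eq (MI.mem_sub h1 h2) ?_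
    push_cast; ring

/-- A scaled upper bound `W.hi ≥ S·(2aω² + 1/a)` for the diagonal remainder constant.
[cite: Moore1966, Ch. 3 (interval arithmetic: inclusion property)] -/
def diagRemBox (S : ℕ) (A Ω : MI) : Option MI :=
  (MI.divPos S (MI.ofInt S 1) A).map fun invA ↦ ((A.mulInt 2).mul S (Ω.sqr S)).add invA

/-- `diagRemBox` encloses `2aω² + 1/a`. [cite: Moore1966, Ch. 3 (interval arithmetic: inclusion property)] -/
theorem mem_diagRemBox (hS : 0 < S) {A Ω W : MI} {ω : ℝ} (hA : MI.mem S a A) (hΩ : MI.mem S ω Ω)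
    (h : diagRemBox S A Ω = some W) : MI.mem S (2 * a * ω ^ 2 + 1 / a) W := by
  unfold diagRemBox at h
  cases hinv : MI.divPos S (MI.ofInt S 1) A with
  | none => simp [hinv] at h
  | some V =>
    simp only [hinv, Option.map_some, Option.some.injEq] at h
    subst h
    have hV := MI.mem_divPos hS hinv (mem_one S) hA
    refine Literature.NumberTheory.LFunctions.Yoshida1992.Encl.mem_of_eq (MI.mem_add (MI.mem_mul hS (MI.mem_mulInt hA 2) (MI.mem_sqr hS hΩ)) hV) ?_
    push_cast; ring

/-- **The diagonal entry box**: tail + alternating sum, widened by `⌈4·max(W.hi,0)/(2K+1)²⌉ ≥ S(2aω²+1/a)/(K+½)²`.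
[cite: Moore1966, Ch. 3 (interval arithmetic: inclusion property)] -/
def diagBox (S Karc : ℕ) (P A EA Ω E0 R : MI) (K : ℕ) : Option MI :=
  match tailBox S Karc P EA, diagSum S A Ω E0 R K, diagRemBox S A Ω with
  | some T, some Y, some W => some ((T.add Y).widen (cdiv (4 * max W.hi 0) ((2 * (K : ℤ) + 1) ^ 2)))
  | _, _, _ => none

/-- ★ `diagBox` encloses `sechIncrCoeff a n n` (`Ω ∋ πn/a`, `n : ℕ`).
[cite: Moore1966, Ch. 3 (interval arithmetic: inclusion property)] -/
theorem mem_diagBox (hS : 0 < S) (ha : 0 < a) {Karc : ℕ} {P A EA Ω E0 R : MI} (hP : MI.mem S Real.pi P)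
    (hA : MI.mem S a A) (hEA : MI.mem S (Real.exp a) EA) {n : ℕ} (hΩ : omegaBox S P A n = some Ω)
    (hE0 : MI.mem S (Real.exp (-a)) E0) (hR : MI.mem S (Real.exp (-(2 * a))) R) {K : ℕ} {Y : MI}
    (h : diagBox S Karc P A EA Ω E0 R K = some Y) :
    MI.mem S (sechIncrCoeff a n n) Y := by
  have hω := mem_omegaBox hS hP hA hΩ
  unfold diagBox at h
  split at h
  · rename_i T Z W hT hZ hW
    simp only [Option.some.injEq] at h
    subst h
    have hTm := mem_tailBox hS hP hEA hT
    have hZm := mem_diagSum hS ha hA hω hE0 hR K hZ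
    have hWm := mem_diagRemBox hS hA hω hW
    have hsum := MI.mem_add hTm hZm
    refine MI.mem_widen hsum ?_
    have hrem := abs_sechDiag_sub_sum_le ha n K
    have hWS : (2 * a * (π * n / a) ^ 2 + 1 / a) * S ≤ ((max W.hi 0 : ℤ) : ℝ) := by
      have := hWm.2; push_cast; exact this.trans (by exact_mod_cast le_max_left _ _)
    have hK : (0 : ℝ) < (K + 1 / 2) ^ 2 := by positivity
    have hS0 : (0 : ℝ) ≤ S := by positivity
    have hden : (0 : ℤ) < (2 * (K : ℤ) + 1) ^ 2 := by positivity
    have hcd := div_le_cdiv (a := 4 * max W.hi 0) hden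
    have e : ∀ x y z : ℝ, x - y - z = x - (y + z) := fun x y z ↦ by ring
    rw [← e]
    calc |sechIncrCoeff a n n - (2 * π - 4 * Real.arctan (Real.exp a)) -
            ∑ k ∈ Finset.range K, (-1 : ℝ) ^ k *
              (2 * ((1 - Real.exp (-((k + 1 / 2) * (2 * a)))) / (k + 1 / 2))
                - 2 * ((k + 1 / 2) * (1 - Real.exp (-((k + 1 / 2) * (2 * a)))) / ((k + 1 / 2) ^ 2 + (π * n / a) ^ 2))
                + (1 / a) * (((k + 1 / 2) ^ 2 - (π * n / a) ^ 2) * (1 - Real.exp (-((k + 1 / 2) * (2 * a))))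
                      / ((k + 1 / 2) ^ 2 + (π * n / a) ^ 2) ^ 2
                    - (2 * a) * Real.exp (-((k + 1 / 2) * (2 * a))) * (k + 1 / 2) / ((k + 1 / 2) ^ 2 + (π * n / a) ^ 2)))| * S
        ≤ (2 * a * (π * n / a) ^ 2 + 1 / a) / (K + 1 / 2) ^ 2 * S := mul_le_mul_of_nonneg_right hrem hS0
      _ = ((2 * a * (π * n / a) ^ 2 + 1 / a) * S) / (K + 1 / 2) ^ 2 := by ring
      _ ≤ ((max W.hi 0 : ℤ) : ℝ) / (K + 1 / 2) ^ 2 := div_le_div_of_nonneg_right hWS hK.le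
      _ = ((4 * max W.hi 0 : ℤ) : ℝ) / (((2 * (K : ℤ) + 1) ^ 2 : ℤ) : ℝ) := by
          push_cast; field_simp; ring
      _ ≤ _ := hcd
  · simp at h

end Boxes

end SechEncl

end Summit.Ventures.WeilGRH

/-! ### Build note
weil-grh-2 gen11, 2026-08-24: append-only re-commit of the file accepted as p365972 (2026-08-23T13:33Z) so that the hub
builder produces its olean (the 13Z–20Z build window of 2026-08-23 was skipped; importer probes answered
`remote:stale:…:unbuilt:Summits.Ventures.WeilGRH.TwistedSechTableDiag` for 19 h).  No declaration is added or changed. -/
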